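import Summits.Ventures.PercRepro.NearDominant
import Summits.Ventures.PercRepro.MSTightConnected
import Summits.Ventures.PercRepro.SingleMergeDim

/-!
# Lemma B in the near-dominant regime, unconditionally

`NearDominant.lean` proved Lemma B for `crossCount ≤ columnCount i + 1` modulo the candidate Prop
`MSTightNoSplit`; `MSTightConnected.lean` proved Theorem 4 (`noSplit_of_tight`) for families of
`Finset α`. This file transports Theorem 4 to families of configurations through the indicator
map `toFinset : Config S → Finset S` (injective, order-reflecting, commuting with `\`), discharges
`msTightNoSplit : MSTightNoSplit`, and states the unconditional corollaries:

* `crossCount_le_topBotCount_of_le_columnCount_add_one'` — three crossing cells, any monotone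
  map: at most one bad pair avoiding a cell ⇒ `crossCount ≤ topBotCount`;
* `lemmaB_cross4_of_le_columnCount_add_one'` — the same for `cross4`.
-/

namespace PercRepro

open Finset
open scoped FinsetFamily

section Transfer

variable {S : Type} [Fintype S] [DecidableEq S]

/-- The indicator finset of a configuration. -/
def toFinset (A : Config S) : Finset S := Finset.univ.filter fun i => A i = true

omit [DecidableEq S] in
/-- Membership in the indicator finset. -/
theorem mem_toFinset {A : Config S} {i : S} : i ∈ toFinset A ↔ A i = true := by
  simp [toFinset]

omit [DecidableEq S] in
/-- The indicator map is injective. -/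
theorem toFinset_injective : Function.Injective (toFinset (S := S)) := by
  intro A B h
  funext i
  have : A i = true ↔ B i = true := by rw [← mem_toFinset, ← mem_toFinset, h]
  cases hA : A i <;> cases hB : B i <;> simp_all

omit [DecidableEq S] in
/-- The indicator map reflects and preserves the order. -/
theorem toFinset_subset_iff {A B : Config S} : toFinset A ⊆ toFinset B ↔ A ≤ B := by
  constructor
  · intro h i
    cases hA : A i
    · exact Bool.false_le _
    · have : B i = true := mem_toFinset.1 (h (mem_toFinset.2 hA))
      rw [this]
  · intro h i hi
    have hA : A i = true := mem_toFinset.1 hi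
    have := h i
    rw [hA] at this
    exact mem_toFinset.2 (Bool.eq_true_of_true_le this)

/-- The indicator map commutes with differences. -/
theorem toFinset_sdiff (A B : Config S) : toFinset (A \ B) = toFinset A \ toFinset B := by
  ext i
  simp only [mem_toFinset, Finset.mem_sdiff, Pi.sdiff_apply]
  cases A i <;> cases B i <;> decide

/-- The difference family transports along the indicator map. -/
theorem image_toFinset_diffs (F : Finset (Config S)) :
    (F \\ F).image toFinset = F.image toFinset \\ F.image toFinset := by
  unfold Finset.diffs
  exact Finset.image_image₂_distrib fun A B => toFinset_sdiff A B

/-- Tightness transports along the indicator map. -/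
theorem tight_image_toFinset {F : Finset (Config S)} (h : (F \\ F).card = F.card) :
    MSTight.Tight (F.image toFinset) := by
  unfold MSTight.Tight
  rw [← image_toFinset_diffs, Finset.card_image_of_injective _ toFinset_injective,
    Finset.card_image_of_injective _ toFinset_injective, h]

/-- **`MSTightNoSplit` holds** (Theorem 4 transported to configurations). -/
theorem msTightNoSplit : MSTightNoSplit := by
  intro S _ _ s t hs ht hdisj htight
  have hns := MSTight.noSplit_of_tight (Finset.univ : Finset S) ((s ∪ t).image toFinset)
    (fun _ _ => Finset.subset_univ _) (tight_image_toFinset htight)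
  have hunion : s.image toFinset ∪ t.image toFinset = (s ∪ t).image toFinset :=
    (Finset.image_union _ _).symm
  have hdisj' : Disjoint (s.image toFinset) (t.image toFinset) :=
    (Finset.disjoint_image toFinset_injective).2 hdisj
  obtain ⟨a', ha', b', hb', hab⟩ := hns _ _ hunion hdisj' (hs.image _) (ht.image _)
  obtain ⟨a, ha, rfl⟩ := Finset.mem_image.1 ha'
  obtain ⟨b, hb, rfl⟩ := Finset.mem_image.1 hb'
  refine ⟨a, ha, b, hb, ?_⟩
  rcases hab with h | h
  · exact Or.inl (toFinset_subset_iff.1 h)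
  · exact Or.inr (toFinset_subset_iff.1 h)

end Transfer

section Corollaries

variable {S : Type} [Fintype S] [DecidableEq S] {k : ℕ}

/-- **Lemma B in the near-dominant regime** (unconditional): for three crossing cells and any
monotone map, if at most one bad pair avoids the cell `x i` then `crossCount ≤ topBotCount`. -/
theorem crossCount_le_topBotCount_of_le_columnCount_add_one' (x : Fin 3 → Setoid (Fin k))
    (c : Config S → Setoid (Fin k)) (hx : IsCrossingFamily x) (hc : Monotone c) (i : Fin 3)
    (h : crossCount x c ≤ columnCount x c i + 1) : crossCount x c ≤ topBotCount c :=
  crossCount_le_topBotCount_of_le_columnCount_add_one x c msTightNoSplit hx hc i h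

/-- **Lemma B for `cross4` in the near-dominant regime** (unconditional): a monotone map with at
most one antipodal pair of some type `{x j₁, x j₂}` satisfies
`crossCount cross4 c ≤ topBotCount c`. -/
theorem lemmaB_cross4_of_le_columnCount_add_one' (c : Config S → Setoid (Fin 4)) (hc : Monotone c)
    (i : Fin 3) (h : crossCount cross4 c ≤ columnCount cross4 c i + 1) :
    crossCount cross4 c ≤ topBotCount c :=
  lemmaB_cross4_of_le_columnCount_add_one msTightNoSplit c hc i h

open Classical in
/-- **A column with both classes present is never Marica–Schönheim-tight**: for an explicit
column `i` with `univ.erase i = {j₁, j₂}` and both classes `crossFam i j₁`, `crossFam i j₂`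
nonempty, `columnCount i + 1 ≤ topBotCount` (the quantitative form of the connectedness theorem
used as the `ms1` counter of the SAT searches). -/
theorem columnCount_add_one_le_topBotCount_of_classes {k : ℕ} (x : Fin 3 → Setoid (Fin k))
    (c : Config S → Setoid (Fin k)) (hx : IsCrossingFamily x) (hc : Monotone c)
    {i j₁ j₂ : Fin 3} (hij₁ : i ≠ j₁) (hij₂ : i ≠ j₂) (hj : j₁ ≠ j₂)
    (huniv : Finset.univ.erase i = {j₁, j₂}) (h₁ : (crossFam x c i j₁).Nonempty)
    (h₂ : (crossFam x c i j₂).Nonempty) : columnCount x c i + 1 ≤ topBotCount c := by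
  by_contra hlt
  push Not at hlt
  have hms1 : columnCount x c i ≤ (columnSet x c i \\ columnSet x c i).card :=
    Finset.card_le_card_diffs _
  have hms2 := card_diffs_columnSet_le_topBotCount x c hx hc i
  have htight : ((crossFam x c i j₁ ∪ crossFam x c i j₂) \\
      (crossFam x c i j₁ ∪ crossFam x c i j₂)).card =
      (crossFam x c i j₁ ∪ crossFam x c i j₂).card := by
    rw [← columnSet_eq_union x c i j₁ j₂ huniv]
    change _ = columnCount x c i
    omega
  obtain ⟨a, ha, b, hb, hab⟩ :=
    msTightNoSplit _ _ h₁ h₂ (disjoint_crossFam_of_ne x c hx.injective i hj) htight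
  exact not_comparable_across x c hx hc hij₁ hij₂ hj ha hb hab

/-- **Every column of a three-type map has `columnCount i + 1 ≤ topBotCount`** (`cross4`, all
three unordered pair-types present): the `ms1` lever is sound. -/
theorem columnCount_add_one_le_topBotCount_of_threeTypes (c : Config S → Setoid (Fin 4))
    (hc : Monotone c) (h3 : ∀ i j : Fin 3, i ≠ j → (crossFam cross4 c i j).Nonempty) (i : Fin 3) :
    columnCount cross4 c i + 1 ≤ topBotCount c := by
  fin_cases i
  · exact columnCount_add_one_le_topBotCount_of_classes cross4 c cross4_isCrossingFamily hc
      (i := 0) (j₁ := 1) (j₂ := 2) (by decide) (by decide) (by decide) (by decide)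
      (h3 0 1 (by decide)) (h3 0 2 (by decide))
  · exact columnCount_add_one_le_topBotCount_of_classes cross4 c cross4_isCrossingFamily hc
      (i := 1) (j₁ := 0) (j₂ := 2) (by decide) (by decide) (by decide) (by decide)
      (h3 1 0 (by decide)) (h3 1 2 (by decide))
  · exact columnCount_add_one_le_topBotCount_of_classes cross4 c cross4_isCrossingFamily hc
      (i := 2) (j₁ := 0) (j₂ := 1) (by decide) (by decide) (by decide) (by decide)
      (h3 2 0 (by decide)) (h3 2 1 (by decide))

/-- The same in the tree's vocabulary: for a map with `ThreeTypes c` (SingleMergeDim) every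
column satisfies `columnCount i + 1 ≤ topBotCount`. -/
theorem columnCount_add_one_le_topBotCount_of_ThreeTypes (c : Config S → Setoid (Fin 4))
    (hc : Monotone c) (h3 : ThreeTypes c) (i : Fin 3) :
    columnCount cross4 c i + 1 ≤ topBotCount c :=
  columnCount_add_one_le_topBotCount_of_threeTypes c hc
    (fun i j hij => by
      obtain ⟨ω, h1, h2⟩ := h3 i j hij
      exact ⟨ω, (mem_crossFam cross4 c).2 ⟨hij, h1, h2⟩⟩) i

end Corollaries

end PercRepro
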